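import Summits.CriticalPhenomena.PercolationContinuityZ3.Theorems.PercNearOneGluingNoHeavyLowerTailSahiOneStepLiteralStep
import Summits.CriticalPhenomena.PercolationContinuityZ3.Theorems.PercNearOneGluingNoHeavyLowerTailSahiOneStepSubblockThresholdFree
import Summits.CriticalPhenomena.PercolationContinuityZ3.Theorems.PercNearOneGluingNoHeavyLowerTailSahiOneStepUniformMonoA
import Summits.CriticalPhenomena.PercolationContinuityZ3.Theorems.PercNearOneGluingNoHeavyLowerTailSahiOneStepFreeStep
import HarnessLib

/-!
# One-step scheme: the AND-LITERAL STEP for an ARBITRARY first event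

Prover prim-ineq-prove-3 gen 26 (`--supports stmt-CriticalPhenomena-4575`; memo
`run/shared/lean/prim/prim-ineq-prove-3/FINDING-G26C-NORMAL-FORM.md` §5).  No definitions, no sorries.

Gen 25's AND/AND step (`osN_threshold_andStep`) needs the pivot `e` to be a top-level AND-literal of BOTH events.  Here the first event
`A` is ARBITRARY:
* `osN_threshold_andLiteral_step` — for every increasing `A` and every increasing `B` not depending on `e` (`e ∉ F`):
  `(2′)` for `(A, {e ∈ ω} ∩ B)` at the slot `{N_{insert e F} ≥ t+1}`  ⟸  `(2′)` for `(A¹, B)` at the slot `{N_F ≥ t}`, `A¹ = {ω | insert e ω ∈ A}`.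
  Proof: gen 15's step form (`osN_ind_ind_nonneg_of_step`); the outer section of `{e ∈ ω} ∩ B` is empty, and the step term `M₂` is
  nonnegative by the hypothesis itself, Harris, the ball monotonicity `μ(A¹ ∣ N_F < t+1) ≥ μ(A¹ ∣ N_F < t)` (`real_inter_ball_mul_le_succ`,
  from layer monotonicity) and `μ(B ∩ {N_F < t}) ≤ μ(B)μ(N_F < t)`:  `ℓ¹·M₂ ≥ ℓ¹(μA¹ − μA⁰)(μ(B ∩ H¹) − μB·μH¹) ≥ 0`.
* `osN_threshold_andBlockThreshold_nonneg`, `sahiE3_threshold_andBlockThreshold_nonneg` — with gen 20's `osN_threshold_blockThreshold_nonneg`: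
  **`(2′)` and Kahn C5 / Sahi `C₃` for EVERY increasing `A` against `B = {e ∈ ω} ∩ {N_T ≥ r}` (a literal AND a block threshold, `e ∉ T`),
  every product measure** — e.g. `B = x_a(x_b ∨ x_c)`, the first non-threshold monotone function of three variables.
-/

noncomputable section

namespace Summit.CriticalPhenomena.PercolationContinuityZ3.Theorems

namespace SahiOneStep

open MeasureTheory Finset
open Literature.Probability.Percolation (DeterminedBy determinedBy_iff determinedBy_univ)
open Literature.Probability.LatticeModels (prodBernoulli sahiE3 prodBernoulli_harris)
open Literature.Probability.Percolation.DecisionTree (ind)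
open scoped Classical

variable {ι : Type*} [Fintype ι]

/-! ## Ball monotonicity -/

/-- **Ball monotonicity (one step).**  For an increasing `U`: `μ(U ∩ {N_F < r})·μ{N_F < r+1} ≤ μ(U ∩ {N_F < r+1})·μ{N_F < r}`, i.e.
`μ(U ∣ N_F < r) ≤ μ(U ∣ N_F < r+1)` — from layer monotonicity. [folklore] -/
theorem real_inter_ball_mul_le_succ (p : ι → unitInterval) (F : Finset ι) {U : Set (Set ι)} (hU : IsUpperSet U) (r : ℕ) :
    (prodBernoulli p).real (U ∩ {ω : Set ι | (F.filter (· ∈ ω)).card < r}) *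
        (prodBernoulli p).real {ω : Set ι | (F.filter (· ∈ ω)).card < r + 1} ≤
      (prodBernoulli p).real (U ∩ {ω : Set ι | (F.filter (· ∈ ω)).card < r + 1}) *
        (prodBernoulli p).real {ω : Set ι | (F.filter (· ∈ ω)).card < r} := by
  set x : ℕ → ℝ := fun j => (prodBernoulli p).real (U ∩ {ω : Set ι | (F.filter (· ∈ ω)).card = j}) with hx
  set y : ℕ → ℝ := fun j => (prodBernoulli p).real {ω : Set ι | (F.filter (· ∈ ω)).card = j} with hy
  have hmono : ∀ j k, j ≤ k → x j * y k ≤ x k * y j := by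
    intro j k hjk
    have h := real_inter_inter_layer_mul_le p F hU (determinedBy_univ ((↑F : Set ι)ᶜ)) hjk
    rw [Set.inter_univ] at h
    simp only [hx, hy]; exact h
  rw [real_inter_ball_eq_sum p F U r, real_inter_ball_eq_sum p F U (r + 1), real_ball_eq_sum p F r, real_ball_eq_sum p F (r + 1)]
  change (∑ j ∈ range r, x j) * (∑ j ∈ range (r + 1), y j) ≤ (∑ j ∈ range (r + 1), x j) * (∑ j ∈ range r, y j)
  rw [Finset.sum_range_succ, Finset.sum_range_succ, mul_add, add_mul]
  have key : (∑ j ∈ range r, x j) * y r ≤ x r * ∑ j ∈ range r, y j := by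
    rw [Finset.sum_mul, Finset.mul_sum]
    exact Finset.sum_le_sum fun j hj => hmono j r (Finset.mem_range.1 hj).le
  linarith [key]

/-! ## The AND-literal step -/

/-- **THE AND-LITERAL STEP for an arbitrary first event.**  Let `e ∉ F`, `A` increasing (arbitrary), `B` increasing and determined by a
coordinate set avoiding `e`.  If `(2′)` holds for the pair `(A¹, B)` at the slot `{N_F ≥ t}`, then it holds for `(A, {e ∈ ω} ∩ B)` at the
slot `{N_{insert e F} ≥ t+1}`. [this work] -/
theorem osN_threshold_andLiteral_step (p : ι → unitInterval) {F : Finset ι} {e : ι} (he : e ∉ F) (t : ℕ)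
    {A B : Set (Set ι)} (hA : IsUpperSet A) (hB : IsUpperSet B) {SB : Finset ι} (hBS : DeterminedBy B (↑SB : Set ι)) (heB : e ∉ SB)
    (hsec : 0 ≤ osN p {ω : Set ι | t ≤ (F.filter (· ∈ ω)).card} (ind {ω : Set ι | insert e ω ∈ A}) (ind B)) :
    0 ≤ osN p {ω : Set ι | t + 1 ≤ ((insert e F).filter (· ∈ ω)).card} (ind A) (ind ({ω : Set ι | e ∈ ω} ∩ B)) := by
  set μ := prodBernoulli p with hμ
  set H1 : Set (Set ι) := {ω : Set ι | t ≤ (F.filter (· ∈ ω)).card} with hH1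
  set H0 : Set (Set ι) := {ω : Set ι | t + 1 ≤ (F.filter (· ∈ ω)).card} with hH0
  set A1 : Set (Set ι) := {ω : Set ι | insert e ω ∈ A} with hA1
  set A0 : Set (Set ι) := {ω : Set ι | ω \ {e} ∈ A} with hA0
  have sH1 : {ω : Set ι | insert e ω ∈ {ω : Set ι | t + 1 ≤ ((insert e F).filter (· ∈ ω)).card}} = H1 := section_insert_threshold he t
  have sH0 : {ω : Set ι | ω \ {e} ∈ {ω : Set ι | t + 1 ≤ ((insert e F).filter (· ∈ ω)).card}} = H0 := section_sdiff_threshold he t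
  have sB1 : {ω : Set ι | insert e ω ∈ ({ω : Set ι | e ∈ ω} ∩ B)} = B := section_insert_and hBS heB
  have sB0 : {ω : Set ι | ω \ {e} ∈ ({ω : Set ι | e ∈ ω} ∩ B)} = ∅ := section_sdiff_and B e
  have hA1u : IsUpperSet A1 := isUpperSet_section_insert hA e
  have hA01 : A0 ⊆ A1 := section_sdiff_subset_section_insert hA e
  have hH1u : IsUpperSet H1 := isUpperSet_threshold F t
  have hH01 : H0 ⊆ H1 := fun ω hω => by simp only [hH0, hH1, Set.mem_setOf_eq] at hω ⊢; omega
  refine osN_ind_ind_nonneg_of_step p {ω : Set ι | t + 1 ≤ ((insert e F).filter (· ∈ ω)).card} A ({ω : Set ι | e ∈ ω} ∩ B) e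
    ?_ ?_ ?_ ?_ ?_ ?_
  · rw [sH1, sB1]; exact hsec
  · rw [sH0, sB0, osN_ind_ind]; simp
  rotate_left
  · rw [sH1, sH0]; exact measureReal_mono hH01
  · exact measureReal_mono hA01
  · rw [sB1, sB0, measureReal_empty]; exact measureReal_nonneg
  rw [sH1, sH0, sB1, sB0]
  simp only [Set.inter_empty, measureReal_empty, sub_zero, mul_zero, add_zero, zero_add]
  change 0 ≤ (μ.real A0 - μ.real (H0 ∩ A0)) * (μ.real B - μ.real (H1 ∩ B)) + (1 - μ.real H0) * μ.real (H1 ∩ A1 ∩ B)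
      - (μ.real H1 - μ.real H0) * μ.real A1 * μ.real B - (1 - μ.real H1) * (μ.real A0 * μ.real B)
  -- the ingredients
  have mA01 : μ.real A0 ≤ μ.real A1 := measureReal_mono hA01
  have mHA01 : μ.real (H0 ∩ A0) ≤ μ.real (H0 ∩ A1) := measureReal_mono (Set.inter_subset_inter_right _ hA01)
  have mH01 : μ.real H0 ≤ μ.real H1 := measureReal_mono hH01
  have mH1le : μ.real H1 ≤ 1 := measureReal_le_one
  have mHBle : μ.real (H1 ∩ B) ≤ μ.real B := measureReal_mono Set.inter_subset_right
  have mHA0le : μ.real (H0 ∩ A0) ≤ μ.real A0 := measureReal_mono Set.inter_subset_right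
  have mHA1le : μ.real (H1 ∩ A1) ≤ μ.real A1 := measureReal_mono Set.inter_subset_right
  have mH0A1le : μ.real (H0 ∩ A1) ≤ μ.real A1 := measureReal_mono Set.inter_subset_right
  have mW_le : μ.real (H1 ∩ A1 ∩ B) ≤ μ.real (A1 ∩ B) := measureReal_mono (by
    rw [Set.inter_assoc]; exact Set.inter_subset_right)
  have mB0 : 0 ≤ μ.real B := measureReal_nonneg
  -- Harris: `μ(A1 ∩ B) ≥ μ A1 μ B` and `μ(H1 ∩ B) ≥ μ H1 μ B`
  have harrisAB : μ.real A1 * μ.real B ≤ μ.real (A1 ∩ B) :=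
    prodBernoulli_harris p hA1u hB MeasurableSet.of_discrete MeasurableSet.of_discrete
  have harrisHB : μ.real H1 * μ.real B ≤ μ.real (H1 ∩ B) :=
    prodBernoulli_harris p hH1u hB MeasurableSet.of_discrete MeasurableSet.of_discrete
  -- the hypothesis, unfolded
  have hsec' := hsec
  rw [osN_ind_ind] at hsec'
  change 0 ≤ μ.real (H1 ∩ A1) * μ.real (H1 ∩ B) + (1 - μ.real H1) * μ.real (H1 ∩ A1 ∩ B)
      + μ.real H1 * μ.real A1 * μ.real B - μ.real (H1 ∩ A1) * μ.real B - μ.real (H1 ∩ B) * μ.real A1 at hsec'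
  -- ball monotonicity for `A1` between radii `t` and `t+1`, rewritten through `H1`, `H0`
  have ball := real_inter_ball_mul_le_succ p F hA1u t
  have cL1 : μ.real (A1 ∩ {ω : Set ι | (F.filter (· ∈ ω)).card < t}) = μ.real A1 - μ.real (H1 ∩ A1) := by
    have h := measureReal_inter_add_sdiff (μ := μ) (s := A1) (t := H1) MeasurableSet.of_discrete
    have hs : A1 \ H1 = A1 ∩ {ω : Set ι | (F.filter (· ∈ ω)).card < t} := by
      ext ω; simp only [hH1, Set.mem_sdiff, Set.mem_inter_iff, Set.mem_setOf_eq, not_le]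
    rw [hs, Set.inter_comm A1 H1] at h; linarith
  have cL0 : μ.real (A1 ∩ {ω : Set ι | (F.filter (· ∈ ω)).card < t + 1}) = μ.real A1 - μ.real (H0 ∩ A1) := by
    have h := measureReal_inter_add_sdiff (μ := μ) (s := A1) (t := H0) MeasurableSet.of_discrete
    have hs : A1 \ H0 = A1 ∩ {ω : Set ι | (F.filter (· ∈ ω)).card < t + 1} := by
      ext ω; simp only [hH0, Set.mem_sdiff, Set.mem_inter_iff, Set.mem_setOf_eq, not_le]
    rw [hs, Set.inter_comm A1 H0] at h; linarith
  have cB1 : μ.real {ω : Set ι | (F.filter (· ∈ ω)).card < t} = 1 - μ.real H1 := by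
    have h := measureReal_inter_add_sdiff (μ := μ) (s := Set.univ) (t := H1) MeasurableSet.of_discrete
    have hs : Set.univ \ H1 = {ω : Set ι | (F.filter (· ∈ ω)).card < t} := by
      ext ω; simp only [hH1, Set.mem_sdiff, Set.mem_univ, true_and, Set.mem_setOf_eq, not_le]
    rw [hs, Set.univ_inter, probReal_univ] at h; linarith
  have cB0 : μ.real {ω : Set ι | (F.filter (· ∈ ω)).card < t + 1} = 1 - μ.real H0 := by
    have h := measureReal_inter_add_sdiff (μ := μ) (s := Set.univ) (t := H0) MeasurableSet.of_discrete
    have hs : Set.univ \ H0 = {ω : Set ι | (F.filter (· ∈ ω)).card < t + 1} := by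
      ext ω; simp only [hH0, Set.mem_sdiff, Set.mem_univ, true_and, Set.mem_setOf_eq, not_le]
    rw [hs, Set.univ_inter, probReal_univ] at h; linarith
  rw [cL1, cL0, cB1, cB0] at ball
  -- ball : (a1 - x1) * (1 - h0) ≤ (a1 - x1') * (1 - h1)
  by_cases hfull : μ.real H1 = 1
  · -- `H1` almost sure: `μ(H1 ∩ B) = μ B`, `μ(H1 ∩ A1 ∩ B) = μ(A1 ∩ B)`
    have hc : μ.real (Set.univ \ H1) = 0 := by
      have h := measureReal_inter_add_sdiff (μ := μ) (s := Set.univ) (t := H1) MeasurableSet.of_discrete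
      rw [Set.univ_inter, probReal_univ, hfull] at h; linarith
    have eHB : μ.real (H1 ∩ B) = μ.real B := by
      have h := measureReal_inter_add_sdiff (μ := μ) (s := B) (t := H1) MeasurableSet.of_discrete
      have h0 : μ.real (B \ H1) = 0 :=
        le_antisymm ((measureReal_mono (Set.sdiff_subset_sdiff_left (Set.subset_univ _))).trans_eq hc) measureReal_nonneg
      rw [Set.inter_comm]; linarith
    have eW : μ.real (H1 ∩ A1 ∩ B) = μ.real (A1 ∩ B) := by
      have h := measureReal_inter_add_sdiff (μ := μ) (s := A1 ∩ B) (t := H1) MeasurableSet.of_discrete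
      have h0 : μ.real ((A1 ∩ B) \ H1) = 0 :=
        le_antisymm ((measureReal_mono (Set.sdiff_subset_sdiff_left (Set.subset_univ _))).trans_eq hc) measureReal_nonneg
      rw [Set.inter_comm, ← Set.inter_assoc] at h; linarith
    rw [eHB, eW, hfull]
    have h0le : μ.real H0 ≤ 1 := measureReal_le_one
    nlinarith [harrisAB, h0le, mA01]
  · have hℓ1 : 0 < 1 - μ.real H1 := sub_pos.2 (lt_of_le_of_ne mH1le hfull)
    -- `ℓ¹·M₂ ≥ ℓ¹ (a1 − a0) (μ(H1∩B) − h1 b) ≥ 0`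
    have key : 0 ≤ (1 - μ.real H1) * ((μ.real A0 - μ.real (H0 ∩ A0)) * (μ.real B - μ.real (H1 ∩ B))
        + (1 - μ.real H0) * μ.real (H1 ∩ A1 ∩ B)
        - (μ.real H1 - μ.real H0) * μ.real A1 * μ.real B - (1 - μ.real H1) * (μ.real A0 * μ.real B)) := by
      have hℓ0 : 0 ≤ 1 - μ.real H0 := sub_nonneg.2 measureReal_le_one
      -- ℓ0 ℓ1 w ≥ ℓ0 (x1 b + zb a1 − x1 zb − h1 a1 b)
      have s1 : (1 - μ.real H0) * (μ.real (H1 ∩ A1) * μ.real B + μ.real (H1 ∩ B) * μ.real A1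
          - μ.real (H1 ∩ A1) * μ.real (H1 ∩ B) - μ.real H1 * μ.real A1 * μ.real B) ≤
          (1 - μ.real H0) * ((1 - μ.real H1) * μ.real (H1 ∩ A1 ∩ B)) :=
        mul_le_mul_of_nonneg_left (by linarith [hsec']) hℓ0
      have hbz : 0 ≤ μ.real B - μ.real (H1 ∩ B) := sub_nonneg.2 mHBle
      -- (b − zb)·[ℓ1 (a0 − x0) − ℓ0 (a1 − x1)] ≥ −(b − zb) ℓ1 (a1 − a0)
      have s2 : -( (μ.real B - μ.real (H1 ∩ B)) * ((1 - μ.real H1) * (μ.real A1 - μ.real A0)) ) ≤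
          (μ.real B - μ.real (H1 ∩ B)) * ((1 - μ.real H1) * (μ.real A0 - μ.real (H0 ∩ A0))
            - (1 - μ.real H0) * (μ.real A1 - μ.real (H1 ∩ A1))) := by
        have inner : -((1 - μ.real H1) * (μ.real A1 - μ.real A0)) ≤
            (1 - μ.real H1) * (μ.real A0 - μ.real (H0 ∩ A0)) - (1 - μ.real H0) * (μ.real A1 - μ.real (H1 ∩ A1)) := by
          nlinarith [ball, mHA01, hℓ1.le]
        nlinarith [inner, hbz]
      have s3 : 0 ≤ (1 - μ.real H1) * (μ.real A1 - μ.real A0) * (μ.real (H1 ∩ B) - μ.real H1 * μ.real B) :=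
        mul_nonneg (mul_nonneg hℓ1.le (sub_nonneg.2 mA01)) (sub_nonneg.2 harrisHB)
      nlinarith [s1, s2, s3]
    exact (mul_nonneg_iff_of_pos_left hℓ1).1 key

/-! ## Corollaries: a literal AND a block threshold against an arbitrary increasing event -/

/-- **`(2′)` for `B = {e ∈ ω} ∩ {N_T ≥ r}` against EVERY increasing `A`** (`e ∉ F`, `e ∉ T`, slot `{N_{insert e F} ≥ t+1}`). [this work] -/
theorem osN_threshold_andBlockThreshold_nonneg (p : ι → unitInterval) {F : Finset ι} {e : ι} (he : e ∉ F) (t : ℕ)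
    {T : Finset ι} (heT : e ∉ T) (r : ℕ) {A : Set (Set ι)} (hA : IsUpperSet A) :
    0 ≤ osN p {ω : Set ι | t + 1 ≤ ((insert e F).filter (· ∈ ω)).card} (ind A)
      (ind ({ω : Set ι | e ∈ ω} ∩ {ω : Set ι | r ≤ (T.filter (· ∈ ω)).card})) :=
  osN_threshold_andLiteral_step p he t hA (isUpperSet_threshold T r) (determinedBy_threshold T r) heT
    (osN_threshold_blockThreshold_nonneg p F t _ T r rfl (isUpperSet_section_insert hA e))

/-- **KAHN C5 / SAHI `C₃` for `{Th_{t+1}(insert e F), A, x_e ∧ Th_r(T)}`** with `A` an ARBITRARY increasing event (`e ∉ F`, `e ∉ T`),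
every product measure — e.g. the middle event `x_a(x_b ∨ x_c)`. [this work] -/
theorem sahiE3_threshold_andBlockThreshold_nonneg (p : ι → unitInterval) {F : Finset ι} {e : ι} (he : e ∉ F) (t : ℕ)
    {T : Finset ι} (heT : e ∉ T) (r : ℕ) {A : Set (Set ι)} (hA : IsUpperSet A) :
    0 ≤ sahiE3 (prodBernoulli p) {ω : Set ι | t + 1 ≤ ((insert e F).filter (· ∈ ω)).card} A
      ({ω : Set ι | e ∈ ω} ∩ {ω : Set ι | r ≤ (T.filter (· ∈ ω)).card}) := by
  have hB : IsUpperSet ({ω : Set ι | e ∈ ω} ∩ {ω : Set ι | r ≤ (T.filter (· ∈ ω)).card}) :=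
    (IsUpperSet.inter (fun ω ω' (hle : ω ≤ ω') (h : e ∈ ω) => hle h) (isUpperSet_threshold T r))
  rw [← osT_ind_ind, osT_eq_osMp_add_osN]
  exact add_nonneg (osMp_threshold_nonneg_all p (insert e F) (t + 1) hA hB)
    (osN_threshold_andBlockThreshold_nonneg p he t heT r hA)

/-- **`(2′)` for `B = {e ∈ ω} ∩ {N_T ≥ r}` against every increasing `A`, for an ARBITRARY slot block `F` and level `t`**
(`e ∉ T`; `e ∈ F` or not). [this work] -/
theorem osN_andBlockThreshold_nonneg (p : ι → unitInterval) (F : Finset ι) (t : ℕ) {e : ι} {T : Finset ι} (heT : e ∉ T) (r : ℕ)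
    {A : Set (Set ι)} (hA : IsUpperSet A) :
    0 ≤ osN p {ω : Set ι | t ≤ (F.filter (· ∈ ω)).card} (ind A)
      (ind ({ω : Set ι | e ∈ ω} ∩ {ω : Set ι | r ≤ (T.filter (· ∈ ω)).card})) := by
  classical
  by_cases he : e ∈ F
  · rcases Nat.eq_zero_or_pos t with ht | ht
    · -- trivial slot
      subst ht
      have huniv : {ω : Set ι | 0 ≤ (F.filter (· ∈ ω)).card} = Set.univ := by ext ω; simp
      rw [huniv, osN_ind_ind]
      simp only [Set.univ_inter, probReal_univ]
      ring_nf; exact le_rfl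
    · obtain ⟨t', rfl⟩ : ∃ t', t = t' + 1 := ⟨t - 1, by omega⟩
      have hF : F = insert e (F.erase e) := (Finset.insert_erase he).symm
      rw [hF]
      exact osN_threshold_andBlockThreshold_nonneg p (F.notMem_erase e) t' heT r hA
  · -- `e` free for the slot: peel it
    have hB1 : {ω : Set ι | insert e ω ∈ ({ω : Set ι | e ∈ ω} ∩ {ω : Set ι | r ≤ (T.filter (· ∈ ω)).card})} =
        {ω : Set ι | r ≤ (T.filter (· ∈ ω)).card} := section_insert_and (determinedBy_threshold T r) heT
    have hB0 : {ω : Set ι | ω \ {e} ∈ ({ω : Set ι | e ∈ ω} ∩ {ω : Set ι | r ≤ (T.filter (· ∈ ω)).card})} = ∅ :=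
      section_sdiff_and _ e
    have hB : IsUpperSet ({ω : Set ι | e ∈ ω} ∩ {ω : Set ι | r ≤ (T.filter (· ∈ ω)).card}) :=
      IsUpperSet.inter (fun ω ω' (hle : ω ≤ ω') (h : e ∈ ω) => hle h) (isUpperSet_threshold T r)
    have z1 : ∀ X : Set (Set ι), osN p {ω : Set ι | t ≤ (F.filter (· ∈ ω)).card} (ind X) (ind (∅ : Set (Set ι))) = 0 := by
      intro X; rw [osN_ind_ind]; simp
    refine osN_threshold_nonneg_of_sections p F t hA hB he ?_ ?_ ?_ ?_
    · rw [hB1]; exact osN_threshold_blockThreshold_nonneg p F t _ T r rfl (isUpperSet_section_insert hA e)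
    · rw [hB0, z1]
    · rw [hB0, z1]
    · rw [hB1]; exact osN_threshold_blockThreshold_nonneg p F t _ T r rfl (isUpperSet_section_sdiff hA e)

/-- **KAHN C5 / SAHI `C₃` FOR {THRESHOLD SLOT, ARBITRARY INCREASING EVENT, LITERAL ∧ BLOCK THRESHOLD}.**  For every product measure,
all blocks `F, T`, all `t, r`, every `e ∉ T` and EVERY increasing `A`:  `0 ≤ E₃(1_{N_F ≥ t}, 1_A, 1_{x_e ∧ N_T ≥ r})`.  With gen 20's
`sahiE3_threshold_blockThreshold_nonneg` this settles Kahn's conjecture (threshold first slot) whenever one of the two other events is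
`x_a`, `x_a x_b`, `x_a ∨ x_b`, AND/OR/MAJ of three, or `x_a(x_b ∨ x_c)`; of the monotone functions of ≤ 3 variables only
`x_a ∨ x_b x_c` remains. [this work] -/
theorem sahiE3_andBlockThreshold_nonneg (p : ι → unitInterval) (F : Finset ι) (t : ℕ) {e : ι} {T : Finset ι} (heT : e ∉ T) (r : ℕ)
    {A : Set (Set ι)} (hA : IsUpperSet A) :
    0 ≤ sahiE3 (prodBernoulli p) {ω : Set ι | t ≤ (F.filter (· ∈ ω)).card} A
      ({ω : Set ι | e ∈ ω} ∩ {ω : Set ι | r ≤ (T.filter (· ∈ ω)).card}) := by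
  have hB : IsUpperSet ({ω : Set ι | e ∈ ω} ∩ {ω : Set ι | r ≤ (T.filter (· ∈ ω)).card}) :=
    IsUpperSet.inter (fun ω ω' (hle : ω ≤ ω') (h : e ∈ ω) => hle h) (isUpperSet_threshold T r)
  rw [← osT_ind_ind, osT_eq_osMp_add_osN]
  exact add_nonneg (osMp_threshold_nonneg_all p F t hA hB) (osN_andBlockThreshold_nonneg p F t heT r hA)

end SahiOneStep

end Summit.CriticalPhenomena.PercolationContinuityZ3.Theorems
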